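import Summits.QuantumFields.BalabanUV.T4Continuum.Support.NE9SpeciesFrameConvention
import Summits.QuantumFields.BalabanUV.T4Continuum.Support.NE9Lemma1CurveSpecies
import Summits.QuantumFields.BalabanUV.T4Continuum.Support.NE9Lemma1KernelSpecies

/-!
# NE9SpeciesDataConvention — the two species data of NE9 ON THE FRAME AT A BOX CONVENTION (`NE9SpeciesFrameConvention`, generation 36,
# located self-correction O-ne9p1g36-1): `curDataConv 𝔟` ∕ `kerDataConv 𝔟` = the tree's `CurData` ∕ `KerData` with the index frame := the
# frame at `𝔟` (boxes, families `Y₀` with `𝔟.anchor ⊆ Y₀`, `Y₀ ∪ 𝔟.box0 = Y`, sources through `𝔟.window`, counting cubes, fibres,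
# cube lists `Δ ⊂ Y₀ ∖ 𝔟.anchor`, `dY = 1 + d_k(Y)`) and the ANALYTIC fields as parameters; every FRAME binder of the END discharged
# (`hLa ∕ hLb` from letters with `𝔟.nA ≤ 10¹²`, `𝔟.nW ≤ c_Q`; `srcScale`; `G1` with `d₀ = 1 + nA + nB`; `hκ₁ ∕ hR ∕ hdY` by `rfl`) and
# `Admissible` reduced to the analytic clauses — so that `printConvention` (print's 2ᵈ-block cover, [I] p. 270) instantiates
# everything the single-cube files of the same generation (p230386 ∕ p230893) gave for `ballConvention` (cell `pub-balaban`, T4-DAG §2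
# node U3 ∕ §6 NE9; BINDER row NE9 OWNER lineage `b2b-balaban-t4-ne9-p1`, generation 36; nothing of any import modified)

HONEST FRAMING (T4-DAG PAGE 1).  Rung (B)+1 of the FINITE-VOLUME T⁴ programme — NOT infinite volume, NOT a mass gap, NOT the
Clay problem.  NE9 (`T4OutputRate.NE9` ∧ `FadingMemory`) is a cell NEW ESTIMATE, NOT PRINTED in [I] = [Balaban1987RG1]
(CMP **109**), [II] = [Balaban1988RG2Cluster] (CMP **116**), and NOT PROVED for Bałaban's E^{(j)} («NE9 ⇐ the named binders»;
spine PROVED 0∕9).  HONEST DEPENDENCY (cell line, verbatim): continuum YM on T⁴ ⇐ BetaPertH ∧ nine spine estimates (0/9 proved);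
BetaPertH ⇐ (D1) ∧ (D4) ∧ CAP+tail; G-an2-4 gates asym, D1 and NE2/3/4.  `FlowStep.BetaPertH`, (B), (B^μ) do not occur.  DATA +
bookkeeping; the analytic content of the species ([I] Lemma 4 (3.53) = `cur_an`; (4.21)–(4.22) = `kerBound`; (G)(S)) stays DISPLAYED
(ABSOLUTE RULE: nothing printed is asserted); 0 sorry.

WHAT.  §1 `cubesListC` (`length = volC`); §3–§4 **`curDataConv R 𝔟 …`**, **`kerDataConv R 𝔟 …`** and the END's frame binders at them:
`levelCountsG_curDataConv` (`hLa`: κ ≥ 144, κ₁ ≥ 69, 0 ≤ θ, L⁴θ⁵ ≤ ω, `𝔟.nA ≤ 10¹²`, `𝔟.nW ≤ c_Q`), `levelCountsG_kerDataConv` (`hLb`,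
general gain), `srcScale_*`, `G1_*` (`d₀ = 1 + nA + nB`); §5 `kappa1_eqC ∕ radius_eqC ∕ frame_dY_eqC` (`rfl`); §6 `admissible_curDataConv`
∕ `admissible_kerDataConv`.  DISGUISE TEST: structure instances + corollaries of the convention frame theorem; no inequality of the series.

References (TYPES ∕ loci only): [Balaban1988RG2Cluster] T. Bałaban, CMP **116** (1988) 1–22, (1.10) p. 4, (1.23)–(1.28) pp. 7–8;
[Balaban1987RG1] T. Bałaban, CMP **109** (1987) 249–301, p. 270, Lemma 4 (3.53)–(3.55) p. 280, (4.17)–(4.22) pp. 285–286.  Summits-side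
NEW work (LEAN PLACEMENT RULE); imports `NE9SpeciesFrameConvention` (generation 36), `NE9Lemma1CurveSpecies`, `NE9Lemma1KernelSpecies`
BY NAME; modifies nothing.  Value = the species data of record at print's convention, NOT summit progress.
-/

noncomputable section

open scoped BigOperators

namespace Summit.QuantumFields.BalabanUV.T4Continuum.NE9SpeciesDataConvention

open Metric Set Complex

open Literature.MathematicalPhysics.QuantumFieldTheory.Balaban1983to89
open Literature.MathematicalPhysics.QuantumFieldTheory.Balaban1983to89.T4OutputRate (Carriers)
open Literature.MathematicalPhysics.QuantumFieldTheory.Balaban1983to89.TreeLengthTorus (TPt TDom)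
open Summit.QuantumFields.BalabanUV.T4Continuum.B13Carriers (TwoRuns)
open Summit.QuantumFields.BalabanUV.T4Continuum.B13DomainGeometryTR
open Summit.QuantumFields.BalabanUV.T4Continuum.NE9ComplexEncoding (doubleCarriers)
open Summit.QuantumFields.BalabanUV.T4Continuum.NE9Lemma1Counting
open Summit.QuantumFields.BalabanUV.T4Continuum.NE9Lemma1Gain
open Summit.QuantumFields.BalabanUV.T4Continuum.NE9Lemma1CurveSpecies
open Summit.QuantumFields.BalabanUV.T4Continuum.NE9Lemma1KernelSpecies
open Summit.QuantumFields.BalabanUV.T4Continuum.NE9Lemma1RemainderSpecies (OnContour)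
open Summit.QuantumFields.BalabanUV.T4Continuum.NE9LevelCountsRecord (multiplicity_fst_le_two)
open Summit.QuantumFields.BalabanUV.T4Continuum.NE9SpeciesFrameOfRecord
open Summit.QuantumFields.BalabanUV.T4Continuum.NE9SpeciesFrameConvention

variable {G : Type} [GaugeGroup G] (R : TwoRuns G) (𝔟 : BoxConvention R)

/-! ## §1 The cube lists `Δ ⊂ Y₀ ∖ □̃⁴` -/

/-- [folklore] DATA: the cubes `Δ ⊂ Y₀ ∖ □̃⁴` of a family, as a list of sigma cubes (the product `Π_{Δ ⊂ Y₀∖□̃⁴} ∫ ds(Δ) …` of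
[Balaban1988RG2Cluster] (1.10) p. 4 ∕ (1.23) p. 7 is indexed by it). -/
def cubesListC (k : ℕ) (a : SCube R) (b : Finset (SCube R)) : List (SCube R) :=
  ((cubesOf R k b \ 𝔟.anchor k a).map (embed R k)).toList

/-- [folklore] The cube list has the paid volume as its length: `#cubesList = vol = #(Y₀ ∖ □̃⁴)`. -/
theorem length_cubesListC (k : ℕ) (a : SCube R) (b : Finset (SCube R)) :
    ((cubesListC R 𝔟 k a b).length : ℝ) = volC R 𝔟 k a b := by
  unfold cubesListC volC
  rw [Finset.length_toList, Finset.card_map]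

/-! ## §3 The curve species (a) at a convention -/

section Cur

variable {E ι : Type}

/-- [folklore] DATA: **THE CURVE-SPECIES DATUM AT A BOX CONVENTION** — the tree's `CurData` ([I] Lemma 4 ∕ [II] (1.23)) with
`S0 ∕ SY ∕ src ∕ Sq ∕ SX ∕ dY ∕ cubes` := the frame at `𝔟` read at `Yout`, and the ANALYTIC fields — `κ₁`, the t_□-radii `r`, the
analyticity radii `Rad` (R_X), the slice curves `cur` (σ′ ↦ U_j(□₀, exp iσ′B)∣_X on the chart) and the slice radii `ϱ` — as the
species' parameters. [cite: Balaban1987RG1, Lemma 4 (3.53) p.280; Balaban1988RG2Cluster, (1.23) p.7] -/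
def curDataConv (Yout : ℕ → ι → R.carriers.Dom) (κ₁ : ℝ) (r : ℕ → ℝ) (Rad : R.carriers.Dom → ℝ)
    (cur : ℕ → (ℕ → ℝ) → ι → SCube R → Finset (SCube R) → (doubleCarriers R.carriers).Dom → ℂ → (SCube R → ℝ) →
      (SCube R → ℂ) → ℂ → E)
    (ϱ : ℕ → (ℕ → ℝ) → ι → SCube R → Finset (SCube R) → (doubleCarriers R.carriers).Dom → ℝ) :
    CurData R.carriers E ι (SCube R) (Finset (SCube R)) (SCube R) (SCube R) where
  S0 := fun k y => boxes R k (Yout k y)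
  SY := fun k y a => famC R 𝔟 k (Yout k y) a
  src := fun k _ a j => srcC R 𝔟 k a j
  Sq := fun k _ a j => cntC R 𝔟 k a j
  SX := fun k _ a j q => fibC R 𝔟 k a j q
  dY := fun k y => 1 + R.carriers.d (Yout k y)
  κ₁ := κ₁
  r := r
  cubes := fun k _ a b => cubesListC R 𝔟 k a b
  cur := cur
  R := Rad
  ϱ := ϱ

variable (Yout : ℕ → ι → R.carriers.Dom) (κ₁ : ℝ) (r : ℕ → ℝ) (Rad : R.carriers.Dom → ℝ)
  (cur : ℕ → (ℕ → ℝ) → ι → SCube R → Finset (SCube R) → (doubleCarriers R.carriers).Dom → ℂ → (SCube R → ℝ) →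
    (SCube R → ℂ) → ℂ → E)
  (ϱ : ℕ → (ℕ → ℝ) → ι → SCube R → Finset (SCube R) → (doubleCarriers R.carriers).Dom → ℝ)

/-- **`hLa` FOR THE CURVE SPECIES AT A CONVENTION** — the level counts of its frame, letters only.
[cite: Balaban1988RG2Cluster, (1.26)-(1.28) p.8] -/
theorem levelCountsG_curDataConv {κ cQ θ ω : ℝ} (hκ : 144 ≤ κ) (hκ₁ : 69 ≤ κ₁) (hθ : 0 ≤ θ)
    (hper : (R.F.L : ℝ) ^ 4 * θ ^ 5 ≤ ω) (hnA : (𝔟.nA : ℝ) ≤ (10 : ℝ) ^ 12) (hw : (𝔟.nW : ℝ) ≤ cQ) :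
    LevelCountsG (curDataConv R 𝔟 Yout κ₁ r Rad cur ϱ).toC.frame κ κ₁ (2 * (2 ^ 20 + 1)) cQ
      (fun k j => agePow θ k j ^ 5) (agePow ω) :=
  levelCountsG_conv (𝔟 := 𝔟) _ Yout (fun _ _ => rfl) (fun _ _ _ => rfl) (fun _ _ _ _ => rfl) (fun _ _ _ _ => rfl)
    (fun _ _ _ _ _ => rfl) (fun k _ a b _ => length_cubesListC R 𝔟 k a b) (fun _ _ => le_rfl) hκ hκ₁ hnA hθ hper hw

/-- **`srcScale` FOR THE CURVE SPECIES AT A CONVENTION** (the `Admissible.srcScale` binder): sources have the creation step of their slot.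
[folklore] -/
theorem srcScale_curDataConv :
    ∀ k y a j, ∀ x ∈ (curDataConv R 𝔟 Yout κ₁ r Rad cur ϱ).src k y a j, R.carriers.scale x.1 = j :=
  fun _ _ _ _ _ hx => scale_of_mem_srcC hx

/-- **`G1` FOR THE CURVE SPECIES AT A CONVENTION** (the `Admissible.G1` binder with `d₀ = 1 + nA + nB`): `dY ≤ (1 + nA + nB) + 4·#cubes`.
[cite: Balaban1988RG2Cluster, (1.25) p.7] -/
theorem G1_curDataConv : ∀ k y, ∀ a ∈ (curDataConv R 𝔟 Yout κ₁ r Rad cur ϱ).S0 k y,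
    ∀ b ∈ (curDataConv R 𝔟 Yout κ₁ r Rad cur ϱ).SY k y a,
      (curDataConv R 𝔟 Yout κ₁ r Rad cur ϱ).dY k y ≤
        (1 + 𝔟.nA + 𝔟.nB : ℝ) + 4 * (((curDataConv R 𝔟 Yout κ₁ r Rad cur ϱ).cubes k y a b).length : ℝ) := by
  intro k y a ha b hb
  show 1 + R.carriers.d (Yout k y) ≤ (1 + 𝔟.nA + 𝔟.nB : ℝ) + 4 * ((cubesListC R 𝔟 k a b).length : ℝ)
  rw [length_cubesListC]
  exact one_add_d_le_volC ha hb

end Cur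

/-! ## §4 The kernel species (b) at a convention -/

section Ker

variable {E ι Pt : Type}

/-- [folklore] DATA: **THE KERNEL-SPECIES DATUM AT A BOX CONVENTION** — the tree's `KerData` ([I] (4.20)–(4.30)) with the frame
fields := the frame at `𝔟` read at `Yout` and the ANALYTIC ∕ GEOMETRIC fields — `κ₁`, `r`, `Rad`, the points `pts` of `□̃⁴`, the base
point `p0`, the distances `dX ∕ ρd`, the power `m` and the bilocal summand `ker` — as the species' parameters.
[cite: Balaban1987RG1, (4.20)-(4.22) pp.285-286] -/
def kerDataConv (Yout : ℕ → ι → R.carriers.Dom) (κ₁ : ℝ) (r : ℕ → ℝ) (Rad : R.carriers.Dom → ℝ)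
    (pts : ℕ → ι → SCube R → Finset Pt) (p0 : R.carriers.Dom → Pt) (dX : R.carriers.Dom → Pt → ℝ) (ρd : Pt → Pt → ℝ) (m : ℕ)
    (ker : ℕ → (ℕ → ℝ) → ι → SCube R → Finset (SCube R) → (doubleCarriers R.carriers).Dom → ℂ → (SCube R → ℝ) →
      (SCube R → ℂ) → Pt → Pt → (E → ℂ) → ℂ) :
    KerData R.carriers E ι (SCube R) (Finset (SCube R)) (SCube R) (SCube R) Pt where
  S0 := fun k y => boxes R k (Yout k y)
  SY := fun k y a => famC R 𝔟 k (Yout k y) a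
  src := fun k _ a j => srcC R 𝔟 k a j
  Sq := fun k _ a j => cntC R 𝔟 k a j
  SX := fun k _ a j q => fibC R 𝔟 k a j q
  dY := fun k y => 1 + R.carriers.d (Yout k y)
  κ₁ := κ₁
  r := r
  cubes := fun k _ a b => cubesListC R 𝔟 k a b
  R := Rad
  pts := pts
  p0 := p0
  dX := dX
  ρd := ρd
  m := m
  ker := ker

variable (Yout : ℕ → ι → R.carriers.Dom) (κ₁ : ℝ) (r : ℕ → ℝ) (Rad : R.carriers.Dom → ℝ)
  (pts : ℕ → ι → SCube R → Finset Pt) (p0 : R.carriers.Dom → Pt) (dX : R.carriers.Dom → Pt → ℝ) (ρd : Pt → Pt → ℝ) (m : ℕ)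
  (ker : ℕ → (ℕ → ℝ) → ι → SCube R → Finset (SCube R) → (doubleCarriers R.carriers).Dom → ℂ → (SCube R → ℝ) →
    (SCube R → ℂ) → Pt → Pt → (E → ℂ) → ℂ)

/-- **`hLb` FOR THE KERNEL SPECIES AT A CONVENTION** — the level counts of its frame with a general gain at any rate `κ' ≥ 144` (the END
reads `κ' = κ − w`), letters only. [cite: Balaban1988RG2Cluster, (1.26)-(1.28) p.8] -/
theorem levelCountsG_kerDataConv {κ' cQ : ℝ} {gain ℓ' : ℕ → ℕ → ℝ} (hκ : 144 ≤ κ') (hκ₁ : 69 ≤ κ₁)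
    (hnA : (𝔟.nA : ℝ) ≤ (10 : ℝ) ^ 12) (hgain : ∀ k j, 0 ≤ gain k j) (hcQℓ : ∀ k j, 0 ≤ cQ * ℓ' k j)
    (hletters : ∀ k j, j ≤ k → (𝔟.nW : ℝ) * ((R.F.L : ℝ) ^ 4) ^ (k - j) * gain k j ≤ cQ * ℓ' k j) :
    LevelCountsG (kerDataConv R 𝔟 Yout κ₁ r Rad pts p0 dX ρd m ker).toC.frame κ' κ₁ (2 * (2 ^ 20 + 1)) cQ gain ℓ' :=
  levelCountsG_conv_gain (𝔟 := 𝔟) _ Yout (fun _ _ => rfl) (fun _ _ _ => rfl) (fun _ _ _ _ => rfl) (fun _ _ _ _ => rfl)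
    (fun _ _ _ _ _ => rfl) (fun k _ a b _ => length_cubesListC R 𝔟 k a b) (fun _ _ => le_rfl) hκ hκ₁ hnA hgain hcQℓ hletters

/-- **`srcScale` FOR THE KERNEL SPECIES AT A CONVENTION**. [folklore] -/
theorem srcScale_kerDataConv :
    ∀ k y a j, ∀ x ∈ (kerDataConv R 𝔟 Yout κ₁ r Rad pts p0 dX ρd m ker).src k y a j, R.carriers.scale x.1 = j :=
  fun _ _ _ _ _ hx => scale_of_mem_srcC hx

/-- **`G1` FOR THE KERNEL SPECIES AT A CONVENTION** (`d₀ = 1 + nA + nB`). [cite: Balaban1988RG2Cluster, (1.25) p.7] -/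
theorem G1_kerDataConv : ∀ k y, ∀ a ∈ (kerDataConv R 𝔟 Yout κ₁ r Rad pts p0 dX ρd m ker).S0 k y,
    ∀ b ∈ (kerDataConv R 𝔟 Yout κ₁ r Rad pts p0 dX ρd m ker).SY k y a,
      (kerDataConv R 𝔟 Yout κ₁ r Rad pts p0 dX ρd m ker).dY k y ≤
        (1 + 𝔟.nA + 𝔟.nB : ℝ) + 4 * (((kerDataConv R 𝔟 Yout κ₁ r Rad pts p0 dX ρd m ker).cubes k y a b).length : ℝ) := by
  intro k y a ha b hb
  show 1 + R.carriers.d (Yout k y) ≤ (1 + 𝔟.nA + 𝔟.nB : ℝ) + 4 * ((cubesListC R 𝔟 k a b).length : ℝ)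
  rw [length_cubesListC]
  exact one_add_d_le_volC ha hb

/-! ## §5 The cross-species identities of the END (`hκ₁ ∕ hR ∕ hdY`), by `rfl` -/

variable (cur : ℕ → (ℕ → ℝ) → ι → SCube R → Finset (SCube R) → (doubleCarriers R.carriers).Dom → ℂ → (SCube R → ℝ) →
    (SCube R → ℂ) → ℂ → E)
  (ϱ : ℕ → (ℕ → ℝ) → ι → SCube R → Finset (SCube R) → (doubleCarriers R.carriers).Dom → ℝ)

/-- [folklore] The two species at a convention share `κ₁` (the END's `hκ₁`). -/
theorem kappa1_eqC : (kerDataConv R 𝔟 Yout κ₁ r Rad pts p0 dX ρd m ker).κ₁ = (curDataConv R 𝔟 Yout κ₁ r Rad cur ϱ).κ₁ := rfl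

/-- [folklore] The two species at a convention share the analyticity radii (the END's `hR`). -/
theorem radius_eqC : (kerDataConv R 𝔟 Yout κ₁ r Rad pts p0 dX ρd m ker).R = (curDataConv R 𝔟 Yout κ₁ r Rad cur ϱ).R := rfl

/-- [folklore] The two species at a convention share the output sizes (the END's `hdY`). -/
theorem frame_dY_eqC : (kerDataConv R 𝔟 Yout κ₁ r Rad pts p0 dX ρd m ker).toC.frame.dY =
    (curDataConv R 𝔟 Yout κ₁ r Rad cur ϱ).toC.frame.dY := rfl

end Ker

/-! ## §6 `Admissible` of the two species from their analytic clauses -/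

section CurAdm

variable {E ι : Type} [NormedAddCommGroup E] [NormedSpace ℂ E] (Yout : ℕ → ι → R.carriers.Dom) (κ₁ : ℝ) (r : ℕ → ℝ)
  (Rad : R.carriers.Dom → ℝ)

variable
  (cur : ℕ → (ℕ → ℝ) → ι → SCube R → Finset (SCube R) → (doubleCarriers R.carriers).Dom → ℂ → (SCube R → ℝ) →
    (SCube R → ℂ) → ℂ → E)
  (ϱ : ℕ → (ℕ → ℝ) → ι → SCube R → Finset (SCube R) → (doubleCarriers R.carriers).Dom → ℝ)

/-- **`hD` AT THE DATA OF RECORD, REDUCED**: `Admissible ℓ cdir (1 + nA + nB)` of the curve species at the convention from `κ₁ ≥ 1`, `r_k > 0`,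
`R_X > 0`, the slice-curve analyticity WITH DOMAIN INCLUSION on the contours ([I] Lemma 4 (3.53) p. 280 — a HYPOTHESIS here, in the
tree's `cur_an` shape at the cube lists of record), `ϱ > 1`, the gain `ϱ⁻¹ ≤ c_dir·ℓ k j` on the index frame of record ((3.54)–(3.55)),
`c_dir ≥ 0`; the frame clauses `srcScale ∕ G1 ∕ d0_nonneg` are discharged by construction.
[cite: Balaban1987RG1, (3.53)-(3.55) p.280; Balaban1988RG2Cluster, (1.25) p.7] -/
theorem admissible_curDataConv {ℓ : ℕ → ℕ → ℝ} {cdir : ℝ} (hκ₁ : 1 ≤ κ₁) (hr : ∀ k, 0 < r k) (hRad : ∀ X, 0 < Rad X)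
    (hcur : ∀ (k : ℕ) (s : ℕ → ℝ) (y : ι) (a : SCube R) (b : Finset (SCube R)) (x : (doubleCarriers R.carriers).Dom),
      ∀ t ∈ sphere (0:ℂ) (r k), ∀ (s' : SCube R → ℝ) (σ' : SCube R → ℂ), OnContour κ₁ (cubesListC R 𝔟 k a b) s' σ' →
        DifferentiableOn ℂ (cur k s y a b x t s' σ') (ball 0 (ϱ k s y a b x)) ∧
          MapsTo (cur k s y a b x t s' σ') (ball 0 (ϱ k s y a b x)) (ball 0 (Rad x.1)))
    (hϱ_gt : ∀ k s y a b x, 1 < ϱ k s y a b x)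
    (hϱ_inv : ∀ (k : ℕ) (s : ℕ → ℝ) (y : ι), ∀ a ∈ boxes R k (Yout k y), ∀ b ∈ famC R 𝔟 k (Yout k y) a, ∀ (j : ℕ),
      ∀ x ∈ srcC R 𝔟 k a j, (ϱ k s y a b x)⁻¹ ≤ cdir * ℓ k j)
    (hcdir : 0 ≤ cdir) :
    (curDataConv R 𝔟 Yout κ₁ r Rad cur ϱ).Admissible ℓ cdir (1 + 𝔟.nA + 𝔟.nB) where
  κ₁_ge := hκ₁
  r_pos := hr
  R_pos := hRad
  cur_an := hcur
  ϱ_gt := hϱ_gt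
  ϱ_inv_le := hϱ_inv
  srcScale := srcScale_curDataConv R 𝔟 Yout κ₁ r Rad cur ϱ
  G1 := G1_curDataConv R 𝔟 Yout κ₁ r Rad cur ϱ
  d0_nonneg := add_nonneg (add_nonneg zero_le_one (Nat.cast_nonneg _)) (Nat.cast_nonneg _)
  cdir_nonneg := hcdir

end CurAdm



section KerAdm

variable {E ι Pt : Type} [NormedAddCommGroup E] [NormedSpace ℂ E] (Yout : ℕ → ι → R.carriers.Dom) (κ₁ : ℝ) (r : ℕ → ℝ)
  (Rad : R.carriers.Dom → ℝ)

variable (pts : ℕ → ι → SCube R → Finset Pt) (p0 : R.carriers.Dom → Pt) (dX : R.carriers.Dom → Pt → ℝ) (ρd : Pt → Pt → ℝ)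
  (m : ℕ)
  (ker : ℕ → (ℕ → ℝ) → ι → SCube R → Finset (SCube R) → (doubleCarriers R.carriers).Dom → ℂ → (SCube R → ℝ) →
    (SCube R → ℂ) → Pt → Pt → (E → ℂ) → ℂ)

/-- **`hK` AT THE DATA OF RECORD, REDUCED**: `Admissible ℓ gain cK δ₀ δ₁ w w0 c0 c1 (1 + nA + nB)` of the kernel species at the convention from
`κ₁ ≥ 1`, `r_k > 0`, `R_X > 0`, `KerZero`, the summand bound **(K)** on the contours for analytic bounded `F` ([I] (4.21)–(4.22)
p. 286 — a HYPOTHESIS here, in the tree's `kerBound` shape at the index frame and cube lists of record), the points' geometry **(G)**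
and lattice sums **(S)** (displayed), and the letters' nonnegativity; the frame clauses `srcScale ∕ G1 ∕ d0_nonneg` are discharged
by construction. [cite: Balaban1987RG1, (4.17)-(4.22) pp.285-286; Balaban1988RG2Cluster, (1.25) p.7] -/
theorem admissible_kerDataConv {ℓ gain : ℕ → ℕ → ℝ} {cK δ₀ δ₁ w w0 c0 c1 : ℝ} (hκ₁ : 1 ≤ κ₁) (hr : ∀ k, 0 < r k)
    (hRad : ∀ X, 0 < Rad X)
    (hzero : ∀ k s y a b x t s' σ' p q, ker k s y a b x t s' σ' p q (0 : E → ℂ) = 0)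
    (hker : ∀ (k : ℕ) (s : ℕ → ℝ) (y : ι), ∀ a ∈ boxes R k (Yout k y), ∀ b ∈ famC R 𝔟 k (Yout k y) a, ∀ (j : ℕ),
      ∀ x ∈ srcC R 𝔟 k a j, ∀ t ∈ sphere (0:ℂ) (r k), ∀ (s' : SCube R → ℝ) (σ' : SCube R → ℂ),
        OnContour κ₁ (cubesListC R 𝔟 k a b) s' σ' → ∀ p ∈ pts k y a, ∀ q ∈ pts k y a, ∀ (F : E → ℂ) (M : ℝ),
          DifferentiableOn ℂ F (ball 0 (Rad x.1)) → (∀ z ∈ ball (0:E) (Rad x.1), ‖F z‖ ≤ M) →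
            ‖ker k s y a b x t s' σ' p q F‖ ≤ cK * M * gain k j * ρd p q ^ m * Real.exp (-(δ₀ * (dX x.1 p + dX x.1 q))))
    (hgeom : ∀ (k : ℕ) (y : ι) (a : SCube R) (x : (doubleCarriers R.carriers).Dom), ∀ p ∈ pts k y a, ∀ q ∈ pts k y a,
      δ₁ * ρd (p0 x.1) p + δ₁ * ρd p q ≤ δ₀ * (dX x.1 p + dX x.1 q) + w * R.carriers.d x.1 + w0)
    (hsum0 : ∀ (k : ℕ) (y : ι) (a : SCube R) (X : R.carriers.Dom), ∑ p ∈ pts k y a, Real.exp (-(δ₁ * ρd (p0 X) p)) ≤ c0)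
    (hsum1 : ∀ (k : ℕ) (y : ι) (a : SCube R), ∀ p ∈ pts k y a, ∑ q ∈ pts k y a, ρd p q ^ m * Real.exp (-(δ₁ * ρd p q)) ≤ c1)
    (hcK : 0 ≤ cK) (hgain : ∀ k j, 0 ≤ gain k j) (hρd : ∀ p q, 0 ≤ ρd p q) (hc0 : 0 ≤ c0) (hc1 : 0 ≤ c1) :
    (kerDataConv R 𝔟 Yout κ₁ r Rad pts p0 dX ρd m ker).Admissible ℓ gain cK δ₀ δ₁ w w0 c0 c1 (1 + 𝔟.nA + 𝔟.nB) where
  κ₁_ge := hκ₁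
  r_pos := hr
  R_pos := hRad
  kerZero := hzero
  kerBound := hker
  geom := hgeom
  sum0 := hsum0
  sum1 := hsum1
  srcScale := srcScale_kerDataConv R 𝔟 Yout κ₁ r Rad pts p0 dX ρd m ker
  G1 := G1_kerDataConv R 𝔟 Yout κ₁ r Rad pts p0 dX ρd m ker
  d0_nonneg := add_nonneg (add_nonneg zero_le_one (Nat.cast_nonneg _)) (Nat.cast_nonneg _)
  cK_nonneg := hcK
  gain_nonneg := hgain
  ρd_nonneg := hρd
  c0_nonneg := hc0
  c1_nonneg := hc1

end KerAdm

end Summit.QuantumFields.BalabanUV.T4Continuum.NE9SpeciesDataConvention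

end
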